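import Summits.QuantumFields.BalabanUV.Beta.GAN24.DressedStepFaceCharges
import Summits.QuantumFields.BalabanUV.Beta.GAN24.DMBondCharges

/-!
# `BalabanUV.Beta.GAN24.DressedHalfVertex` — binder row G-an2-4 ∕ (CONV-C), W-slot CT-W, conservation law (C)∕(C)sym, step (P5)(II-a′) of this lineage's note
# `HOME/b2b-balaban-gan24-formalise-leaf-04/g65/CSYM-LEVEL0-KERNEL-BLUEPRINT.md`: **THE BACKGROUND-SUMMED CHAIN-RULE VERTEX THROUGH A KERNEL WITH SITE-DEPENDENT
# COLUMN CHARGES, AND THROUGH THE DRESSED STEP KERNEL: `Σ_{u′} vertexOfK X̃♮_j Lc S ν u′ = Lc·s_f s_m·σ_j · Σ'_t [t_ν at the exit face]·S ν t`** — the dressed half-vertex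
# reads the table's background bond on the ν-exit FACE (every level `j`, every local stencil family `S`)

NOT IN PRINT; OUR BOOKKEEPING ([folklore] Fubini BY NAME: leaf-06 gen 9's `GAN24.DMBondCharges.hasSum_vertexOfK_bond` re-run with a site-dependent column charge `ρR g w`
(`hasSum_fibre_swap`, `ResolventLegCharges.tsum_exp_coarse_le' ∕ summable_exp_coarse'`), the sibling `GAN24.DressedStepFaceCharges.hasSum_dressedStep_col`, an2∕an4's
`AxialDressingRooted.decays_coDressKBmAt`, `OneStepKernelFamily.decays_KInvStep ∕ colH ∕ vertexOfK`, `HessKerDressedUnits.decays_unitK`; G-an2-4 formalisation swarm, leaf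
prover `b2b-balaban-gan24-formalise-leaf-04`, gen 65).  HONEST FRAMING (cell contract, verbatim): «discharging `BetaPertH` makes Bałaban's UV stability UNCONDITIONAL — a
real constructive-QFT result; it is NOT the continuum limit and NOT the Clay problem.»  HONEST DEPENDENCY (verbatim): «continuum YM on T⁴ ⇐ BetaPertH ∧ nine spine estimates
(0/9 proved); BetaPertH ⇐ (D1) ∧ (D4) ∧ CAP+tail; G-an2-4 gates asym, D1 and NE2/3/4.»

WHY (blueprint §1 (II)): in the EE exchange word of the dressed one-step source the second background bond `b′ = (ν, u′)` of `(dM_b ∘ X̃♮) ∘ dM_{b′}` runs over the lattice;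
`dM = vertexOfK + vertexOfM` and `vertexOfK X N S ν u′ = Σ_{κ′} wsum (colH X N ν u′ κ′) (S κ′)` weights the cubic table by the `ℋ`-column of the kernel; summed over `u′`
the weight is the kernel's field–multiplier column CHARGE — site-free `δ_{κ′ν}·σ_j` for the undressed step kernel, the ν-exit-FACE profile `[t_ν % Lc = Lc−1]·Lc·δ·σ_j` for the
dressed one.  So the background-summed dressed half-vertex is the cubic table contracted with the FACE indicator in its background slot — the first of the two face weights
that make the cubic Wilson table the EDGE CURRENT (`GAN24.WilsonFaceHalfVertex`, `GAN24.WilsonEdgeCurrent`).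

WHAT ([folklore]; 0 `def`, 0 cited facts, 0 `def … : Prop`, 0 sorry): §1 **`hasSum_vertexOfK_bond_site`** (generic `K` decaying at rate `m`, column charges `ρR g w`, `S` local at
rate `m`: `HasSum (u′ ↦ vertexOfK K N S ν u′ p q c e) (Σ_κ Σ'_t ρR (inl κ) t·S κ t p q c e)`); §2 **`hasSum_vertexOfK_dressedStep`** (in-block root `ρ = toSite r`, `1 ≤ Lc`, every `j`,
all units `s_f s_m`, every local stencil family `S`: `HasSum (u′ ↦ vertexOfK (unitK s_f s_m (coDressKBmAt ρ Lc (KInvStep Lc j))) Lc S ν u′ p q c e) (Lc·(s_m s_f)·σ_j·Σ'_t [t_ν % Lc =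
Lc−1]·S ν t p q c e)`).  Asserts NO value of Bałaban's tables; discharges NOTHING of (C)sym ∕ (Q-D) ∕ (Q-D-rate) ∕ «T2Shape» ∕ «T2Drift» ∕ (hW, hWall); NEVER «G-an2-4
closed» as (CONV-C); NOT D1, NOT `BetaPertH`, NOT continuum, NOT Clay.  2026-08-22; no existing file touched.
-/

noncomputable section

open Finset
open scoped BigOperators
open Literature.MathematicalPhysics.QuantumFieldTheory
open Literature.MathematicalPhysics.QuantumFieldTheory.Balaban1983to89
open Literature.MathematicalPhysics.QuantumFieldTheory.Balaban1983to89.Beta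
open B12Sec2to5 (l1 l1_nonneg)
open ExpKernelCalculus (Site MKer BiLoc Decays comp Zl Zl_nonneg summable_exp_shift summable_exp_shift')
open OneStepResolventKernel (Fib LocStencil wsum decays_mono)
open BalabanStepJets (locStencil_mono)
open OneStepKernelFamily (KInvStep decays_KInvStep colH abs_colH_le vertexOfK)
open AffineAveraging (box toSite)
open Summit.QuantumFields.BalabanUV.Beta.AxialDressingRooted (coDressKBmAt decays_coDressKBmAt)
open Summit.QuantumFields.BalabanUV.Beta.HessKerDressedUnits (unitK decays_unitK)
open Summit.QuantumFields.BalabanUV.Beta.GAN24.ResolventLegCharges (tsum_exp_coarse_le' summable_exp_coarse')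
open Summit.QuantumFields.BalabanUV.Beta.GAN24.DMBondCharges (hasSum_fibre_swap)
open Summit.QuantumFields.BalabanUV.Beta.GAN24.DressedStepFaceCharges (hasSum_dressedStep_col)

namespace Summit.QuantumFields.BalabanUV.Beta.GAN24.DressedHalfVertex

variable {d : ℕ} {N : ℕ} [NeZero N]

/-! ## §1 The background-summed chain-rule vertex, site-dependent column charges -/

/-- [folklore] **TABLE-BOND SUM OF THE CHAIN-RULE VERTEX THROUGH SITE-DEPENDENT COLUMN CHARGES** (leaf-06 gen 9's `DMBondCharges.hasSum_vertexOfK_bond` re-run with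
`ρR g w`): `K` decaying (rate `m > 0`) with column charges `Σ_{u′} K w (N•u′) g (inr ν) = ρR g w`, `S` a local stencil family (rate `m`) ⟹
`HasSum (u′ ↦ vertexOfK K N S ν u′ p q c e) (Σ_κ Σ'_t ρR (inl κ) t · S κ t p q c e)` — the background slot of the table is weighted by the charge PROFILE. -/
theorem hasSum_vertexOfK_bond_site {K : MKer (d + 1) (Fib d)} {C m : ℝ} (hK : Decays K C m) (hm : 0 < m) (ν : Fin (d + 1))
    {ρR : Fib d → Site (d + 1) → ℝ} (hcol : ∀ g w, HasSum (fun z' : Site (d + 1) => K w ((N : ℤ) • z') g (Sum.inr ν)) (ρR g w))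
    {S : Fin (d + 1) → Site (d + 1) → MKer (d + 1) (Fib d)} {Cs : ℝ} (hS : LocStencil S Cs m)
    (p q : Site (d + 1)) (c e : Fib d) :
    HasSum (fun u' : Site (d + 1) => vertexOfK K N S ν u' p q c e)
      (∑ κ : Fin (d + 1), ∑' t : Site (d + 1), ρR (Sum.inl κ) t * S κ t p q c e) := by
  have hN : 1 ≤ N := Nat.one_le_iff_ne_zero.2 (NeZero.ne N)
  have hC : 0 ≤ C := hK.nonneg (Sum.inl 0)
  have hCs : 0 ≤ Cs := (hS 0 0).nonneg (Sum.inl 0)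
  have hU0 : 0 ≤ Real.exp (m * ((N : ℝ) * (d + 1))) * Zl (d + 1) m := mul_nonneg (Real.exp_pos _).le (Zl_nonneg hm)
  -- one colour `κ` at a time
  have key : ∀ κ : Fin (d + 1), HasSum (fun u' : Site (d + 1) => ∑' t : Site (d + 1), colH K N ν u' κ t * S κ t p q c e)
      (∑' t : Site (d + 1), ρR (Sum.inl κ) t * S κ t p q c e) := by
    intro κ
    -- the double family `(t, u′)` and its majorant
    have hGle : ∀ tu : Site (d + 1) × Site (d + 1), |colH K N ν tu.2 κ tu.1 * S κ tu.1 p q c e|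
        ≤ (Cs * Real.exp (-m * l1 (p - tu.1))) * (C * Real.exp (-m * l1 (tu.1 - (N : ℤ) • tu.2))) := by
      intro tu
      rw [abs_mul, mul_comm]
      refine mul_le_mul ?_ (abs_colH_le (N := N) hK ν tu.2 κ tu.1) (abs_nonneg _) (mul_nonneg hCs (Real.exp_pos _).le)
      refine (hS κ tu.1 p q c e).trans (mul_le_mul_of_nonneg_left ?_ hCs)
      rw [Real.exp_le_exp]
      nlinarith [l1_nonneg (q - tu.1), l1_nonneg (p - tu.1)]
    have hM0 : 0 ≤ fun tu : Site (d + 1) × Site (d + 1) =>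
        (Cs * Real.exp (-m * l1 (p - tu.1))) * (C * Real.exp (-m * l1 (tu.1 - (N : ℤ) • tu.2))) := fun tu => by positivity
    have hMfib : ∀ t : Site (d + 1), Summable fun u' : Site (d + 1) =>
        (Cs * Real.exp (-m * l1 (p - t))) * (C * Real.exp (-m * l1 (t - (N : ℤ) • u'))) :=
      fun t => ((summable_exp_coarse' (d := d) hN hm t).mul_left C).mul_left _
    have hb : ∀ t : Site (d + 1),
        ∑' u' : Site (d + 1), (Cs * Real.exp (-m * l1 (p - t))) * (C * Real.exp (-m * l1 (t - (N : ℤ) • u')))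
          ≤ (Cs * C * (Real.exp (m * ((N : ℝ) * (d + 1))) * Zl (d + 1) m)) * Real.exp (-m * l1 (p - t)) := by
      intro t
      rw [tsum_mul_left, tsum_mul_left]
      have h1 := tsum_exp_coarse_le' (d := d) N hm t
      have h0 : 0 ≤ Cs * Real.exp (-m * l1 (p - t)) := by positivity
      have h2 := mul_le_mul_of_nonneg_left (mul_le_mul_of_nonneg_left h1 hC) h0
      refine h2.trans (le_of_eq ?_)
      ring
    have hMsum : Summable fun t : Site (d + 1) =>
        ∑' u' : Site (d + 1), (Cs * Real.exp (-m * l1 (p - t))) * (C * Real.exp (-m * l1 (t - (N : ℤ) • u'))) :=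
      Summable.of_nonneg_of_le (fun t => tsum_nonneg fun u' => hM0 (t, u')) hb ((summable_exp_shift hm p).mul_left _)
    have hmaj : Summable fun tu : Site (d + 1) × Site (d + 1) =>
        (Cs * Real.exp (-m * l1 (p - tu.1))) * (C * Real.exp (-m * l1 (tu.1 - (N : ℤ) • tu.2))) :=
      (summable_prod_of_nonneg hM0).2 ⟨hMfib, hMsum⟩
    have hGs : Summable fun tu : Site (d + 1) × Site (d + 1) => colH K N ν tu.2 κ tu.1 * S κ tu.1 p q c e :=
      Summable.of_norm_bounded hmaj (fun tu => by rw [Real.norm_eq_abs]; exact hGle tu)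
    -- `u′`-fibres at fixed `t`: the column charge
    have hfib : ∀ t : Site (d + 1), HasSum (fun u' : Site (d + 1) => colH K N ν u' κ t * S κ t p q c e)
        (ρR (Sum.inl κ) t * S κ t p q c e) := fun t => (hcol (Sum.inl κ) t).mul_right (S κ t p q c e)
    exact hasSum_fibre_swap hGs hfib
  have h := hasSum_sum (s := (Finset.univ : Finset (Fin (d + 1)))) fun κ _ => key κ
  refine h.congr_fun fun u' => ?_
  simp only [vertexOfK, wsum]

/-! ## §2 The W-slot instance: the background-summed vertex through the dressed step kernel reads the exit-FACE sum of the table -/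

section Step

variable {Lc : ℕ} [NeZero Lc] {r : Fin (d + 1) → ℕ}

/-- [folklore] **THE BACKGROUND-SUMMED CHAIN-RULE VERTEX THROUGH THE DRESSED STEP KERNEL** `X̃♮_j = unitK s_f s_m (coDressKBmAt ρ Lc (KInvStep Lc j))` (in-block root,
`1 ≤ Lc`, every `j`, all units): for every local stencil family `S` and every pair of kernel legs,
`Σ_{u′} vertexOfK X̃♮_j Lc S ν u′ p q c e = Lc·s_f s_m·σ_j · Σ'_t [t_ν % Lc = Lc − 1]·S ν t p q c e`, `σ_j = (Lc^{j+1})^{−(d+2)}` — the table's background bond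
reads the ν-EXIT-FACE profile (the dressed (Q-lin) column charge of `GAN24.DressedStepFaceCharges.hasSum_dressedStep_col`), not the site-free constant of the
undressed kernel (`DMBondCharges.hasSum_vertexOfK_bond`: `σ_j·Σ'_t S ν t`). -/
theorem hasSum_vertexOfK_dressedStep (hLc : 1 ≤ Lc) (hr : r ∈ box (d + 1) Lc) (sf sm : ℝ) (j : ℕ) (ν : Fin (d + 1))
    {S : Fin (d + 1) → Site (d + 1) → MKer (d + 1) (Fib d)} {Cs δs : ℝ} (hS : LocStencil S Cs δs) (hδs : 0 < δs)
    (p q : Site (d + 1)) (c e : Fib d) :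
    HasSum (fun u' : Site (d + 1) => vertexOfK (unitK sf sm (coDressKBmAt (toSite r) Lc (KInvStep (d := d) Lc j))) Lc S ν u' p q c e)
      (((Lc : ℝ) * (sm * sf)) * ((((Lc ^ (j + 1) : ℕ) : ℝ)) ^ (d + 1 + 1))⁻¹ *
        ∑' t : Site (d + 1), (if t ν % (Lc : ℤ) = (Lc : ℤ) - 1 then S ν t p q c e else 0)) := by
  obtain ⟨δ, C', hδ, hC', hK'⟩ := decays_coDressKBmAt hLc hr (decays_KInvStep (d := d) (Lc := Lc) j)
  have hKu : Decays (unitK sf sm (coDressKBmAt (toSite r) Lc (KInvStep (d := d) Lc j))) (max |sf| |sm| * C' * max |sf| |sm|) δ := decays_unitK hK'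
  have hCs : 0 ≤ Cs := (hS 0 0).nonneg (Sum.inl 0)
  have hCu : 0 ≤ max |sf| |sm| * C' * max |sf| |sm| := hKu.nonneg (Sum.inl 0)
  set m : ℝ := min δ δs with hm
  have hm0 : 0 < m := lt_min hδ hδs
  have hKm : Decays (unitK sf sm (coDressKBmAt (toSite r) Lc (KInvStep (d := d) Lc j))) (max |sf| |sm| * C' * max |sf| |sm|) m :=
    decays_mono hKu hCu le_rfl (min_le_left _ _)
  have hSm : LocStencil S Cs m := locStencil_mono hS hCs (min_le_right _ _)
  have h := hasSum_vertexOfK_bond_site (N := Lc) hKm hm0 ν (fun g w => hasSum_dressedStep_col (d := d) hLc hr sf sm j ν g w) hSm p q c e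
  convert h using 1
  simp only [Sum.elim_inl]
  rw [Finset.sum_eq_single ν]
  · rw [← tsum_mul_left]
    refine tsum_congr fun t => ?_
    simp only [if_true]
    split_ifs <;> ring
  · intro κ _ hκ
    rw [if_neg hκ]
    simp
  · intro hν
    exact absurd (Finset.mem_univ ν) hν

end Step

end Summit.QuantumFields.BalabanUV.Beta.GAN24.DressedHalfVertex

end
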